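import Summits.CriticalPhenomena.Ising3DConformalLimit.Theorems.IsingEuclidUpgradeIsingEuclidUpgradeR2RotInvPowerLawTowerRays
import Summits.CriticalPhenomena.Ising3DConformalLimit.Theorems.IsingEuclidUpgradeIsingEuclidUpgradeR2RotInvPowerLawRigidity
import Summits.CriticalPhenomena.Ising3DConformalLimit.Theorems.InverseSquareTelemetryPowerLawFromTelemetry
import Summits.CriticalPhenomena.Ising3DConformalLimit.Theorems.InverseSquareTelemetryPositiveSolutionAsymptoticsFinal
import Summits.CriticalPhenomena.Ising3DConformalLimit.Theses.InverseSquareTelemetry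
import HarnessLib

/-!
# Crux `IsingEuclidUpgradeR2RotInvPowerLaw` (stmt-CriticalPhenomena-0634), line `tower_profile_rigidity`:
# kernel-visible UPSTREAMS of the open stubs T1, Sray, A_rays

The line has reduced the crux r2 (isotropic pure power law of the critical `ℤ³` Ising two-point function
`G := criticalTwoPoint 3`) to `T1 ∧ Sray` (landed `rotInvPowerLaw_iff_towerLaw_and_rayLaw`) and to
`T1 ∧ S2 ∧ A_rays` (landed `rotInvPowerLaw_iff_towerLaw_and_dilationLaw_and_rayProfiles`). This file records,
as theorems with the registered names, which EXISTING open items of the sub-problem imply the open stubs, so that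
a landing elsewhere propagates here mechanically:

* `towerLaw_of_inverseSquareLaw` — item stmt-CriticalPhenomena-4495 `InverseSquareTelemetry.InverseSquareLaw`
  (telemetric inverse-square law with a Dini rate; OPEN) ⇒ T1, through the landed telemetry glue
  `powerLawFromTelemetry_proof` (item 4498) fed with the landed Agmon asymptotics `positiveSolutionAsymptotics_proof`
  (item 4496) and `towerLaw_of_rotInvPowerLaw`;
* `rayLaw_of_existsScaleCovariantLimit` — item stmt-CriticalPhenomena-1981 `HyperoctahedralRP.ExistsScaleCovariantLimit`
  (existence of a scale-covariant limit; OPEN) ⇒ Sray, through the landed `RayRV.rayRV_of_existsScaleCovariantLimit`;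
* `rayLaw_of_pointwiseLimit` — item stmt-CriticalPhenomena-6153 `MirrorHoelderCompactness.PointwiseLimit` (OPEN)
  ⇒ Sray, through the landed `RayRV.rayRV_of_pointwiseLimit`;
* `rayProfiles_of_ratioIsotropy` — ratio isotropy S3 (`G(x)/g(⌊|x|₂⌋) → 1` cofinitely; the conclusion of the
  landed `stub_rayRigidityTransfer`, hence of Sray) ⇒ A_rays with `c_v = 1`.

Conversely Sray returns the order-two content of item 1981 (`RayRV.pairLimit_of_rayRV`), so no cheaper upstream of
Sray exists in the ledger. References: Duminil-Copin, ICM 2022, §8.1/§8.4 [DuminilCopinICM2022]. No definitions.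
-/

noncomputable section

namespace Summit.CriticalPhenomena.Ising3DConformalLimit.Cruxes.IsingEuclidUpgradeR2RotInvPowerLaw.TowerProfileRigidity

open Filter Topology Literature.Probability.LatticeModels
open Summit.CriticalPhenomena.Ising3DConformalLimit.HarmonicMomentsIsotropyTwoPoint.RayRV
  (rayRV_of_existsScaleCovariantLimit rayRV_of_pointwiseLimit)

/-- **Item 4495 ⇒ T1.** The telemetric inverse-square law (`InverseSquareTelemetry.InverseSquareLaw`,
item stmt-CriticalPhenomena-4495, open) gives the crux through the landed items 4498/4496, hence the dyadic tower
law. [cite: DuminilCopinICM2022, §8.1] -/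
theorem towerLaw_of_inverseSquareLaw : Summit.CriticalPhenomena.Ising3DConformalLimit.Theses.InverseSquareTelemetry.InverseSquareLaw → ∃ Δ c : ℝ, 0 < c ∧ Filter.Tendsto (fun j : ℕ => Literature.Probability.LatticeModels.criticalTwoPoint 3 (Pi.single 0 ((2 ^ j : ℕ) : ℤ)) * ((2 ^ j : ℕ) : ℝ) ^ (2 * Δ)) Filter.atTop (nhds c) :=
  fun h => towerLaw_of_rotInvPowerLaw
    (Summit.CriticalPhenomena.Ising3DConformalLimit.Theorems.powerLawFromTelemetry_proof h
      Summit.CriticalPhenomena.Ising3DConformalLimit.Theorems.positiveSolutionAsymptotics_proof)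

/-- **Item 1981 ⇒ Sray.** Existence of a scale-covariant limit of the critical correlators
(`HyperoctahedralRP.ExistsScaleCovariantLimit`, item stmt-CriticalPhenomena-1981, open) gives ray regular variation
(landed `rayRV_of_existsScaleCovariantLimit`), i.e. the ray dilation law (`rayLaw_of_rayRV`).
[cite: DuminilCopinICM2022, §8.4] -/
theorem rayLaw_of_existsScaleCovariantLimit : Summit.CriticalPhenomena.Ising3DConformalLimit.Theses.HyperoctahedralRP.ExistsScaleCovariantLimit → ∃ Δ : ℝ, ∀ v : Literature.Probability.LatticeModels.Site 3, v ≠ 0 → ∀ k : ℕ, 1 ≤ k → Filter.Tendsto (fun n : ℕ => Literature.Probability.LatticeModels.criticalTwoPoint 3 (((k * n : ℕ) : ℤ) • v) * (k : ℝ) ^ (2 * Δ) / Literature.Probability.LatticeModels.criticalTwoPoint 3 (((n : ℕ) : ℤ) • v)) Filter.atTop (nhds 1) :=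
  fun hEX => rayLaw_of_rayRV (rayRV_of_existsScaleCovariantLimit hEX)

/-- **Item 6153 ⇒ Sray.** `MirrorHoelderCompactness.PointwiseLimit` (item stmt-CriticalPhenomena-6153, open) gives
ray regular variation (landed `rayRV_of_pointwiseLimit`), i.e. the ray dilation law. [cite: DuminilCopinICM2022, §8.4] -/
theorem rayLaw_of_pointwiseLimit : Summit.CriticalPhenomena.Ising3DConformalLimit.Theses.MirrorHoelderCompactness.PointwiseLimit → ∃ Δ : ℝ, ∀ v : Literature.Probability.LatticeModels.Site 3, v ≠ 0 → ∀ k : ℕ, 1 ≤ k → Filter.Tendsto (fun n : ℕ => Literature.Probability.LatticeModels.criticalTwoPoint 3 (((k * n : ℕ) : ℤ) • v) * (k : ℝ) ^ (2 * Δ) / Literature.Probability.LatticeModels.criticalTwoPoint 3 (((n : ℕ) : ℤ) • v)) Filter.atTop (nhds 1) :=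
  fun hPL => rayLaw_of_rayRV (rayRV_of_pointwiseLimit hPL)

/-- **S3 ⇒ A_rays (with `c_v = 1`).** Ratio isotropy `G(x)/g(⌊|x|₂⌋) → 1` cofinitely, pulled back along the
injective ray `n ↦ n v` (`tendsto_natSmul_cofinite`) and rewritten with `|nv|₂ = n|v|₂` (`sqrt_sum_sq_natSmul`), is
the ray-wise existence of the angular ratio with limit `1`. [folklore] -/
theorem rayProfiles_of_ratioIsotropy : Filter.Tendsto (fun x : Literature.Probability.LatticeModels.Site 3 => Literature.Probability.LatticeModels.criticalTwoPoint 3 x / Literature.Probability.LatticeModels.criticalTwoPoint 3 (Pi.single 0 ((⌊Real.sqrt (∑ i, ((x i : ℝ)) ^ 2)⌋₊ : ℕ) : ℤ))) Filter.cofinite (nhds 1) → ∀ v : Literature.Probability.LatticeModels.Site 3, v ≠ 0 → ∃ c : ℝ, 0 < c ∧ Filter.Tendsto (fun n : ℕ => Literature.Probability.LatticeModels.criticalTwoPoint 3 (((n : ℕ) : ℤ) • v) / Literature.Probability.LatticeModels.criticalTwoPoint 3 (Pi.single 0 ((⌊(n : ℝ) * Real.sqrt (∑ i, ((v i : ℝ))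 ^ 2)⌋₊ : ℕ) : ℤ))) Filter.atTop (nhds c) := by
  intro hS3 v hv
  refine ⟨1, one_pos, ?_⟩
  have h := hS3.comp (tendsto_natSmul_cofinite v hv)
  refine h.congr fun n => ?_
  simp only [Function.comp_apply]
  rw [sqrt_sum_sq_natSmul]

end Summit.CriticalPhenomena.Ising3DConformalLimit.Cruxes.IsingEuclidUpgradeR2RotInvPowerLaw.TowerProfileRigidity

end
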